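import Summits.AtomisticToContinuum.BoseEinsteinCondensation.Theorems.BlockLatticeFSumBlockCondensationCellNKeyInequality
import Literature.MathematicalPhysics.QuantumManyBody.EnergyLocalizationCellMethod
import Literature.MathematicalPhysics.QuantumManyBody.BoseGasFreeDirichletBEC
import Literature.MathematicalPhysics.QuantumManyBody.PeriodicBoseGas
import Literature.MathematicalPhysics.QuantumManyBody.BoseGasThermodynamicLimitRuelle
import HarnessLib
import HarnessLib.Audit

/-!
# `BlockCondensation` (stmt-AtomisticToContinuum-13595): the cellN-carrier engine spec
# halves F♭₊ / F♭₀, `F♭₀ ⟸ CellNKeyInequality` PROVED (decomp-a2c · lens-6 · gen 28 / hand-1 g9)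

Companion of the gen-27 node `BlockCondensationCarving.lean` (`13595 ⟸ U ∧ F`, `F ⟸ F♭`,
U = `LSSY2005_upperBound_periodic` PROVED) and of the memo `CARRIER-CHANGE-13595-P1.md`
(critic row 391 (3)(i)): it TYPES, over tree declarations only and importing BUILT modules only,

* **P1's target** `CellNEngine` — the deterministic budget-form floor inequality
  `natCast_le_sum_occupation_add_budget` (`BoseGasSubcellCondensationSharp.lean` :71) RE-TYPED
  over the boundary-condition-free carrier (`ψ : Config (n+1) → ℂ`, `C¹`, Bose-symmetric,
  normalised on `cellN (n+1) L`; plain cell energy budget; occupations of `1_{cellN} ψ`), every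
  other binder VERBATIM — this is the exact signature hand-1's Literature module has to prove
  (the memo lists the six carrier-dependent lemmas and the three Dirichlet-only spots);
* **P4's engine** `CellNKeyInequality` — the free sub-cell gap inequality `key_inequality`
  (`BoseGasFreeDirichletBEC.lean` :450) re-typed over the same carrier;
* the two halves `CellNBudgetBlockFloorPos` (F♭₊, `a > 0`: P3) and `CellNBudgetBlockFloorZero`
  (F♭₀, `a = 0`: P4) of the tree leaf `BlockCondensationCarving.CellNBudgetBlockFloor` (F♭, the
  gen-27 carving node; the join `F♭ ⟸ F♭₊ ∧ F♭₀` and the route-level doors live in the companion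
  `BlockLatticeFSumBlockCondensationDoor.lean`, so that THIS module stays route-independent — it
  imports no `Theses` file);

and PROVES **P4 modulo its engine**: `F♭₀ ⟸ CellNKeyInequality`
(`cellNBudgetBlockFloorZero_of_keyInequality`; slack `τ := η π² / (4A²)`, no diluteness needed), and —
the engine being the tree theorem `cellN_key_inequality` (hand-2 g8, binder for binder) —
`cellNKeyInequality_holds`, hence **F♭₀ unconditionally** (`cellNBudgetBlockFloorZero_holds`).  What
remains for 13595 after this file: P1 (`CellNEngine`, L, mechanical transport) and
P3 = `CellNEngine → CellNBudgetBlockFloorPos` (M; the parameter block of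
`floor_of_scatteringLength_pos_sharp` with `ρ := N/L³`, `Cu := 0`, slack split `τ = 4πa·t`,
`N₀ := 1`, memo §3); hand-1 g9 lands the spec (lens-6 g28 source sha 23db3d3f) for the close.  Tags: F♭₊ WEAKER·ATTACKABLE (KNOWN·L,
[LSSY2005, Thm 5.1, Lemma 5.2 (5.5)–(5.14), (5.15)–(5.17)]); F♭₀ WEAKER·ATTACKABLE (S/M);
`CellNEngine`, `CellNKeyInequality` = COSTUME(cite)-grade transports of tree theorems
(`natCast_le_sum_occupation_add_budget`, `key_inequality`) to a weaker carrier — [folklore].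
-/

noncomputable section

open MeasureTheory Set
open scoped ENNReal NNReal BigOperators

namespace Summit.AtomisticToContinuum.BoseEinsteinCondensation.Theorems.BlockCondensationCellNEngine

open Literature.MathematicalPhysics.QuantumManyBody.BoseGas

/-- **P1 target — the cellN-carrier engine.**  `natCast_le_sum_occupation_add_budget`
(`BoseGasSubcellCondensationSharp.lean` :71–91) with the Dirichlet state `Ψ : TrialState (n+1) L`
replaced by a `C¹`, Bose-symmetric `ψ` normalised on the fundamental cell `[0,L)^{3(n+1)}`, the
energy hypothesis by the PLAIN cell energy `∫_{cellN} (|∇ψ|² + ∑_{i<j} v |ψ|²) ≤ U`, and the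
occupations taken of `1_{cellN} ψ`; all other binders verbatim (Lemma 4.1 shape `h41`, excluded
volume `hW`, `hy`, localized / Neumann lower bounds `hloc` / `hE0`, bookkeeping `hcomb`, `hκ`,
`hUBA`).  Conclusion: `N ≤ ∑_q ⟨u_q, γ u_q⟩ + (2Cs²(U + B − A) + CwU)`.
[cite: LSSY2005, Lemma 5.2 (5.7)–(5.14), (5.15)–(5.17); folklore (carrier form)] -/
@[conjecture] def CellNEngine : Prop :=
  ∀ (n K : ℕ) (s L : ℝ), 0 < s → 0 < K → (K : ℝ) * s = L → 0 < L →
  ∀ (v : ℝ → ℝ≥0∞), Measurable v →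
  ∀ (ψ : Config (n + 1) → ℂ), ContDiff ℝ 1 ψ →
    (∀ (σ : Equiv.Perm (Fin (n + 1))) (X : Config (n + 1)), ψ (X ∘ σ) = ψ X) →
    ∫⁻ X in cellN (n + 1) L, (‖ψ X‖₊ : ℝ≥0∞) ^ 2 = 1 →
  ∀ (good : ℕ → Prop) [DecidablePred good] (Rf yf lb : ℕ → ℝ) (C w Ur A B κ : ℝ),
    0 ≤ C → 0 ≤ w → 0 ≤ Ur → 0 ≤ A → 0 ≤ B →
    (∀ (L : ℝ), 0 < L → ∀ (f : Space → ℂ), ContDiff ℝ 1 f →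
      ∀ (Ω : Set Space), MeasurableSet Ω → Ω ⊆ cell L →
        ∫⁻ x in cell L, (‖f x - ⨍ y in cell L, f y‖₊ : ℝ≥0∞) ^ 2 ≤
          ENNReal.ofReal C *
            (ENNReal.ofReal (L ^ 2) * (∫⁻ x in Ω, gradSqC f x) +
              volume (cell L \ Ω) ^ (2 / 3 : ℝ) * ∫⁻ x in cell L, gradSqC f x)) →
    (∀ m : ℕ, good (m + 1) →
      ((m : ℝ≥0∞) * (ENNReal.ofReal (Rf (m + 1)) ^ 3 * ENNReal.ofReal (Real.pi * 4 / 3))) ^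
        (2 / 3 : ℝ) ≤ ENNReal.ofReal w) →
    (∀ m, good m → 0 ≤ yf m ∧ yf m ≤ 1 / 2) →
    (∀ m, good m → ENNReal.ofReal (lb m) ≤ locGroundStateEnergy (yf m) (Rf m) v m s) →
    (∀ m, ¬ good m → ENNReal.ofReal (lb m) ≤ neumannGroundStateEnergy v m s) →
    (∀ nv : Fin (K ^ 3) → ℕ, ∑ c, nv c = n + 1 →
      ENNReal.ofReal A + ENNReal.ofReal κ * ∑ c, (if good (nv c) then 0 else (nv c : ℝ≥0∞)) ≤
        (∑ c, ENNReal.ofReal (lb (nv c))) + ENNReal.ofReal B) →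
    1 ≤ 2 * C * s ^ 2 * κ →
    ∫⁻ X in cellN (n + 1) L, kineticDensity ψ X + interaction v X * (‖ψ X‖₊ : ℝ≥0∞) ^ 2 ≤
      ENNReal.ofReal Ur →
    A ≤ Ur + B →
    ((n + 1 : ℕ) : ℝ≥0∞) ≤
      (∑ q : SubIdx K, occupation (n + 1) (subMode s q) ((cellN (n + 1) L).indicator ψ)) +
        ENNReal.ofReal (2 * C * s ^ 2 * (Ur + B - A) + C * w * Ur)

/-- **P4 engine — the free sub-cell gap inequality on the cellN carrier.**  `key_inequality`
(`BoseGasFreeDirichletBEC.lean` :450) re-typed: for a `C¹`, Bose-symmetric `ψ` normalised on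
`cellN (n+1) L`, `L = kℓ`, `(π/ℓ)² N ≤ ∫_{cellN} |∇ψ|² + (π/ℓ)² ∑_q ⟨u_q, γ u_q⟩` — every particle is
either kinetically excited at the Neumann sub-cell gap or condensed into a sub-cell constant
mode (no boundary condition is used: the Poincaré inequality is per sub-cell).
[cite: LSSY2005, Ch. 5 (5.15)–(5.17); folklore (carrier form)] -/
@[conjecture] def CellNKeyInequality : Prop :=
  ∀ (n k : ℕ) (ℓ L : ℝ), 0 < ℓ → (k : ℝ) * ℓ = L →
  ∀ (ψ : Config (n + 1) → ℂ), ContDiff ℝ 1 ψ →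
    (∀ (σ : Equiv.Perm (Fin (n + 1))) (X : Config (n + 1)), ψ (X ∘ σ) = ψ X) →
    ∫⁻ X in cellN (n + 1) L, (‖ψ X‖₊ : ℝ≥0∞) ^ 2 = 1 →
    ENNReal.ofReal ((Real.pi / ℓ) ^ 2) * ((n + 1 : ℕ) : ℝ≥0∞) ≤
      (∫⁻ X in cellN (n + 1) L, kineticDensity ψ X) +
        ENNReal.ofReal ((Real.pi / ℓ) ^ 2) *
          ∑ q : SubIdx k, occupation (n + 1) (subMode ℓ q) ((cellN (n + 1) L).indicator ψ)

/-- **F♭₊ (P3)**: `CellNBudgetBlockFloor` for potentials with POSITIVE scattering length (the LSSY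
cell mechanism at the GP scale; transport of `floor_of_scatteringLength_pos_sharp` with
`ρ := N/L³`, `Cu := 0`, slack `τρN`). [cite: LSSY2005, Thm. 5.1, Lemma 5.2; folklore (carrier form)] -/
@[conjecture] def CellNBudgetBlockFloorPos : Prop :=
  ∀ v : ℝ → ℝ≥0∞, IsRepulsiveFiniteRange v → 0 < scatteringLength v → ∀ A : ℝ, 0 < A →
    ∀ η : ℝ, 0 < η →
    ∃ ρ₀ : ℝ, 0 < ρ₀ ∧ ∃ τ : ℝ, 0 < τ ∧ ∃ N₀ : ℕ, ∀ (N : ℕ) (L : ℝ), 0 < L → N₀ ≤ N →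
      (N : ℝ) ≤ ρ₀ * L ^ 3 → ∀ ψ : Config N → ℂ, ContDiff ℝ 1 ψ →
        (∀ (σ : Equiv.Perm (Fin N)) (X : Config N), ψ (X ∘ σ) = ψ X) →
        ∫⁻ X in cellN N L, (‖ψ X‖₊ : ℝ≥0∞) ^ 2 = 1 →
        ∫⁻ X in cellN N L, kineticDensity ψ X + interaction v X * (‖ψ X‖₊ : ℝ≥0∞) ^ 2 ≤
          ENNReal.ofReal
            ((4 * Real.pi * (scatteringLength v).toReal + τ) * ((N : ℝ) / L ^ 3) * N) →
        ∀ K : ℕ, Even K → 0 < K →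
          A / Real.sqrt ((N : ℝ) / L ^ 3) ≤ L / (K : ℝ) ∧
            L / (K : ℝ) ≤ 2 * A / Real.sqrt ((N : ℝ) / L ^ 3) →
          ENNReal.ofReal ((1 - η) * N) ≤
            ∑ q : SubIdx K, occupation N (subMode (L / (K : ℝ)) q) ((cellN N L).indicator ψ)

/-- **F♭₀ (P4)**: `CellNBudgetBlockFloor` for potentials with ZERO scattering length (free-like
case: the budget is `τρN` and the sub-cell gap alone forces the floor).
[cite: LSSY2005, Ch. 5 (5.15)–(5.17); folklore (carrier form)] -/
@[conjecture] def CellNBudgetBlockFloorZero : Prop :=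
  ∀ v : ℝ → ℝ≥0∞, IsRepulsiveFiniteRange v → scatteringLength v = 0 → ∀ A : ℝ, 0 < A →
    ∀ η : ℝ, 0 < η →
    ∃ ρ₀ : ℝ, 0 < ρ₀ ∧ ∃ τ : ℝ, 0 < τ ∧ ∃ N₀ : ℕ, ∀ (N : ℕ) (L : ℝ), 0 < L → N₀ ≤ N →
      (N : ℝ) ≤ ρ₀ * L ^ 3 → ∀ ψ : Config N → ℂ, ContDiff ℝ 1 ψ →
        (∀ (σ : Equiv.Perm (Fin N)) (X : Config N), ψ (X ∘ σ) = ψ X) →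
        ∫⁻ X in cellN N L, (‖ψ X‖₊ : ℝ≥0∞) ^ 2 = 1 →
        ∫⁻ X in cellN N L, kineticDensity ψ X + interaction v X * (‖ψ X‖₊ : ℝ≥0∞) ^ 2 ≤
          ENNReal.ofReal
            ((4 * Real.pi * (scatteringLength v).toReal + τ) * ((N : ℝ) / L ^ 3) * N) →
        ∀ K : ℕ, Even K → 0 < K →
          A / Real.sqrt ((N : ℝ) / L ^ 3) ≤ L / (K : ℝ) ∧
            L / (K : ℝ) ≤ 2 * A / Real.sqrt ((N : ℝ) / L ^ 3) →
          ENNReal.ofReal ((1 - η) * N) ≤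
            ∑ q : SubIdx K, occupation N (subMode (L / (K : ℝ)) q) ((cellN N L).indicator ψ)

/-- Real arithmetic of the free-like case: with `τ = ηπ²/(4A²)` and `s ≤ 2A/√ρ`,
`τ ρ ≤ η (π/s)²`. [folklore] -/
theorem tau_rho_le {A η ρ s : ℝ} (hA : 0 < A) (hη : 0 ≤ η) (hρ : 0 < ρ) (hs : 0 < s)
    (hsu : s ≤ 2 * A / Real.sqrt ρ) :
    η * Real.pi ^ 2 / (4 * A ^ 2) * ρ ≤ η * (Real.pi / s) ^ 2 := by
  have hsr : 0 < Real.sqrt ρ := Real.sqrt_pos.2 hρ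
  have h1 : s * Real.sqrt ρ ≤ 2 * A := by
    rwa [le_div_iff₀ hsr] at hsu
  have h2 : s ^ 2 * ρ ≤ 4 * A ^ 2 := by
    have h3 : (s * Real.sqrt ρ) ^ 2 ≤ (2 * A) ^ 2 :=
      pow_le_pow_left₀ (by positivity) h1 2
    have h4 : (s * Real.sqrt ρ) ^ 2 = s ^ 2 * ρ := by
      rw [mul_pow, Real.sq_sqrt hρ.le]
    nlinarith [h3, h4]
  have hs2 : 0 < s ^ 2 := by positivity
  have hA2 : 0 < 4 * A ^ 2 := by positivity
  have hq : ρ / (4 * A ^ 2) ≤ 1 / s ^ 2 := by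
    rw [div_le_div_iff₀ hA2 hs2]; nlinarith [h2]
  have hπ : 0 ≤ η * Real.pi ^ 2 := by positivity
  calc η * Real.pi ^ 2 / (4 * A ^ 2) * ρ = η * Real.pi ^ 2 * (ρ / (4 * A ^ 2)) := by ring
    _ ≤ η * Real.pi ^ 2 * (1 / s ^ 2) := mul_le_mul_of_nonneg_left hq hπ
    _ = η * (Real.pi / s) ^ 2 := by rw [div_pow]; ring

/-- **P4 modulo its engine**: the free sub-cell gap inequality on the cellN carrier gives the
zero-scattering-length half of the leaf, with `ρ₀ := 1` (any), `τ := ηπ²/(4A²)`, `N₀ := 1`.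
[cite: LSSY2005, Ch. 5 (5.15)–(5.17); folklore] -/
theorem cellNBudgetBlockFloorZero_of_keyInequality (hkey : CellNKeyInequality) :
    CellNBudgetBlockFloorZero := by
  intro v hv h0 A hA η hη
  refine ⟨1, one_pos, η * Real.pi ^ 2 / (4 * A ^ 2), by positivity, 1, ?_⟩
  intro N L hL hN1 hNρ ψ hψ hsymm hnorm hE K hKev hK hwin
  obtain ⟨n, rfl⟩ : ∃ n, N = n + 1 := ⟨N - 1, by omega⟩
  -- the scale and the density of the box
  set s : ℝ := L / (K : ℝ) with hs_def
  have hKr : (0 : ℝ) < K := by exact_mod_cast hK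
  have hs : 0 < s := div_pos hL hKr
  have hKs : (K : ℝ) * s = L := by rw [hs_def]; field_simp
  set ρ : ℝ := ((n + 1 : ℕ) : ℝ) / L ^ 3 with hρ_def
  have hρ : 0 < ρ := by positivity
  -- the engine
  have hk := hkey n K s L hs hKs ψ hψ hsymm hnorm
  set P : ℝ≥0∞ := ENNReal.ofReal ((Real.pi / s) ^ 2) with hP_def
  have hPpos : (0 : ℝ) < (Real.pi / s) ^ 2 := by positivity
  have hP0 : P ≠ 0 := by
    rw [hP_def]; exact (ENNReal.ofReal_pos.2 hPpos).ne'
  have hPtop : P ≠ ⊤ := ENNReal.ofReal_ne_top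
  set S : ℝ≥0∞ := ∑ q : SubIdx K,
    occupation (n + 1) (subMode s q) ((cellN (n + 1) L).indicator ψ) with hS_def
  -- the budget controls the kinetic energy: `T ≤ τ ρ N ≤ η (π/s)² N`
  have ha0 : (scatteringLength v).toReal = 0 := by rw [h0]; rfl
  have hT : (∫⁻ X in cellN (n + 1) L, kineticDensity ψ X) ≤
      P * ENNReal.ofReal (η * ((n + 1 : ℕ) : ℝ)) := by
    calc (∫⁻ X in cellN (n + 1) L, kineticDensity ψ X)
        ≤ ∫⁻ X in cellN (n + 1) L,
            kineticDensity ψ X + interaction v X * (‖ψ X‖₊ : ℝ≥0∞) ^ 2 :=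
          lintegral_mono fun X => le_self_add
      _ ≤ ENNReal.ofReal ((4 * Real.pi * (scatteringLength v).toReal +
            η * Real.pi ^ 2 / (4 * A ^ 2)) * (((n + 1 : ℕ) : ℝ) / L ^ 3) * ((n + 1 : ℕ) : ℝ)) := hE
      _ = ENNReal.ofReal (η * Real.pi ^ 2 / (4 * A ^ 2) * ρ * ((n + 1 : ℕ) : ℝ)) := by
          rw [ha0, hρ_def]; ring_nf
      _ ≤ ENNReal.ofReal (η * (Real.pi / s) ^ 2 * ((n + 1 : ℕ) : ℝ)) := by
          refine ENNReal.ofReal_le_ofReal ?_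
          exact mul_le_mul_of_nonneg_right (tau_rho_le hA hη.le hρ hs hwin.2) (by positivity)
      _ = P * ENNReal.ofReal (η * ((n + 1 : ℕ) : ℝ)) := by
          rw [hP_def, ← ENNReal.ofReal_mul hPpos.le]; ring_nf
  -- cancel `(π/s)²`
  have hmain : ((n + 1 : ℕ) : ℝ≥0∞) ≤ ENNReal.ofReal (η * ((n + 1 : ℕ) : ℝ)) + S := by
    have h1 : P * ((n + 1 : ℕ) : ℝ≥0∞) ≤ P * (ENNReal.ofReal (η * ((n + 1 : ℕ) : ℝ)) + S) := by
      calc P * ((n + 1 : ℕ) : ℝ≥0∞) ≤ (∫⁻ X in cellN (n + 1) L, kineticDensity ψ X) + P * S := hk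
        _ ≤ P * ENNReal.ofReal (η * ((n + 1 : ℕ) : ℝ)) + P * S := add_le_add hT le_rfl
        _ = P * (ENNReal.ofReal (η * ((n + 1 : ℕ) : ℝ)) + S) := by rw [mul_add]
    exact (ENNReal.mul_le_mul_iff_right hP0 hPtop).1 h1
  -- conclude
  rcases le_or_gt 1 η with hη1 | hη1
  · rw [ENNReal.ofReal_of_nonpos (mul_nonpos_of_nonpos_of_nonneg (by linarith) (by positivity))]
    exact bot_le
  have hsplit : ((n + 1 : ℕ) : ℝ≥0∞) =
      ENNReal.ofReal ((1 - η) * ((n + 1 : ℕ) : ℝ)) + ENNReal.ofReal (η * ((n + 1 : ℕ) : ℝ)) := by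
    rw [← ENNReal.ofReal_add (mul_nonneg (by linarith) (by positivity)) (by positivity),
      ← ENNReal.ofReal_natCast]
    congr 1; ring
  rw [hsplit, add_comm (ENNReal.ofReal (η * _)) S] at hmain
  exact (ENNReal.add_le_add_iff_right ENNReal.ofReal_ne_top).1 hmain

/-! ### F♭₀ discharged -/

/-- **P4 engine discharged**: `CellNKeyInequality` IS the tree theorem `cellN_key_inequality`
(`Theorems/BlockLatticeFSumBlockCondensationCellNKeyInequality.lean`, hand-2 g8), binder for binder.
[cite: LSSY2005, Ch. 5 (5.15)–(5.17)] -/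
theorem cellNKeyInequality_holds : CellNKeyInequality :=
  BlockLatticeFSumBlockCondensationCellNKeyInequality.cellN_key_inequality

/-- **F♭₀ holds**: the zero-scattering-length half of the leaf, unconditionally.
[cite: LSSY2005, Ch. 5 (5.15)–(5.17)] -/
theorem cellNBudgetBlockFloorZero_holds : CellNBudgetBlockFloorZero :=
  cellNBudgetBlockFloorZero_of_keyInequality cellNKeyInequality_holds

end Summit.AtomisticToContinuum.BoseEinsteinCondensation.Theorems.BlockCondensationCellNEngine

end
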